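import Summits.QuantumFields.QCD.Theorems.PauliWegnerSeaChiralGluonicCompletionRestrict

/-!
# Crux `ChiralGluonicCompletion` (stmt-QuantumFields-17498), line `Sketch` (card strongly-chiral-subsequence) —
# the chirality engine E from the HEREDITARY PIN and the lattice gap (lead cycle 3, 2026-08-17)

The composition of the line (`chiralGluonicCompletion_of_stubs`, p134547) consumes E in the form
`∃ φ, (reg.restrict φ).HasGoldstoneBound` (the eventual Goldstone lower bound along a subsequence).  This file proves
that, OVER the lattice-gap stub C1 (a uniform lattice gap at every positive mass tuple), E is equivalent to the
purely order-theoretic core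

  `(E*)  ∃ φ, ∀ ψ, ((reg.restrict φ).restrict ψ).IsChiralAtZero`  — the pin along some subsequence, HEREDITARILY,

so that the registered E-stub of the line can be weakened to E* (flavour-uniform; no clause-(iii) rates, no sign input
at `N_f = 3`):

* `exists_restrict_hasGoldstoneBoundAt` — **single-scale selection**: the pin of `reg` and a uniform lattice gap at
  the pin's mass tuple give, for each single rate `ε > 0`, a subsequence `reg.restrict ψ` with `HasGoldstoneBoundAt ε`.
  (The pin at rate `ε/2` produces, for every constant `C`, frequent violations of the `ε/2`-gap bound in one channel;
  the gap bound `C₀ e^{-Δ a_k n}` at the same mass forces the violating separations to have `a_k n_k → ∞` as `C → ∞`;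
  select `k_j` increasing with violations at level `max C₀ 1 · e^{j}`.)
* `hasGoldstoneBoundAt_restrict_of_eventuallyEq` — the Goldstone bound at a rate passes along eventual reindexings
  (`Θ₂ j = Θ₁ (θ j)` for large `j`, `θ → ∞`).
* `exists_diagonal` — the abstract diagonal argument (adapted from the private lemma of the same name in
  `PauliWegnerSeaGluonicCompletionDiagonal.lean`, namespace `CertifiedSeaThresholdGraft`).
* `exists_restrict_hasGoldstoneBound` — **E from E* over C1**: if the pin holds along EVERY subsequence of `reg` and
  `reg` has a uniform lattice gap at every positive tuple, some subsequence carries the full Goldstone bound (nested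
  single-scale selections at rates `1/(i+1)`, then the diagonal).
* `hereditaryPin_of_hasGoldstoneBound` — conversely E ⟹ E* (Literature `HasGoldstoneBound.isChiralAtZero_restrict`).
* `hereditaryPin_of_eventual` — E* holds with `φ = id` as soon as the pin's violations are EVENTUAL in `k` (the
  `∀ᶠ`-upgrade of `IsChiralAtZero`), which is what every honest chiral regularisation delivers; this is the exact
  amount by which the crux's typed pin (`∃ᶠ`) falls short of closing E.
-/

noncomputable section

namespace Summit.QuantumFields.QCD.Theorems.StronglyChiralSubsequence

open MeasureTheory Filter Topology
open Literature.MathematicalPhysics.QuantumFieldTheory Literature.MathematicalPhysics.QuantumLattice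
  Literature.Probability.LatticeModels

variable {Nf : ℕ}

/-- Restricting twice is restricting along the composite (definitional). -/
theorem restrict_restrict (reg : QCDRegularisation Nf) (φ : ℕ → ℕ) (hφ : Tendsto φ atTop atTop)
    (ψ : ℕ → ℕ) (hψ : Tendsto ψ atTop atTop) :
    (reg.restrict φ hφ).restrict ψ hψ = reg.restrict (φ ∘ ψ) (hφ.comp hψ) :=
  rfl

/-! ## §1 Single-scale selection -/

/-- **Single-scale Goldstone selection.**  If `reg` is chiral at zero and has a uniform lattice gap at every positive
mass tuple, then for every rate `ε > 0` some subsequence `reg.restrict ψ` has the Goldstone bound at rate `ε`: in the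
channel `(A, B)` and at the tuple `m` witnessing the pin at rate `ε/2`, along the selected cutoffs the connected
correlation exceeds `e^{-(ε/2) a_k n_k}` at separations with `a_k n_k → ∞` (forced by the gap bound at `m`). -/
theorem exists_restrict_hasGoldstoneBoundAt (reg : QCDRegularisation Nf) (hpin : reg.IsChiralAtZero)
    (hgap : ∀ m : Fin Nf → ℝ, (∀ f, 0 < m f) → ∃ Δ > 0, (reg.scheme m 0 0).HasLatticeMassGap Δ)
    {ε : ℝ} (hε : 0 < ε) :
    ∃ ψ : ℕ → ℕ, ∃ hψ : StrictMono ψ, (reg.restrict ψ hψ.tendsto_atTop).HasGoldstoneBoundAt ε := by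
  obtain ⟨m, hm, hng⟩ := hpin (ε / 2) (half_pos hε)
  obtain ⟨Δ, hΔ, hG⟩ := hgap m hm
  -- the pin at rate `ε/2`: one channel violating every constant frequently
  simp only [QCDScheme.HasLatticeMassGap, not_forall, not_exists, Filter.not_eventually, not_le] at hng
  obtain ⟨R, R', A, B, hviol⟩ := hng
  -- the gap bound at the same tuple, in the same channel
  obtain ⟨C₀, hC₀⟩ := hG R R' A B
  set C₁ : ℝ := max C₀ 1 with hC₁
  have hC₁1 : 1 ≤ C₁ := le_max_right _ _
  have hC₀1 : C₀ ≤ C₁ := le_max_left _ _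
  -- for every level `j`, a cutoff `k ≥ j` with the gap bound and a violation at level `C₁ e^j`
  have key : ∀ j : ℕ, ∃ k : ℕ, j ≤ k ∧ ∃ S : ℕ, reg.L k ≤ S ∧ ∃ n : ℕ, n ≤ S ∧
      C₁ * Real.exp j * Real.exp (-(ε / 2 * (reg.a k * n))) <
        ‖qcdLatticeConnectedCorr (reg.β k) (2 * S + 1) (fun fl => (reg.scheme m 0 0).mq fl k) A B n‖ ∧
      ‖qcdLatticeConnectedCorr (reg.β k) (2 * S + 1) (fun fl => (reg.scheme m 0 0).mq fl k) A B n‖ ≤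
        C₀ * Real.exp (-(Δ * (reg.a k * n))) := by
    intro j
    obtain ⟨k, hk₁, hk₂, hk₃⟩ :=
      ((hviol (C₁ * Real.exp j)).and_eventually (hC₀.and (eventually_ge_atTop j))).exists
    obtain ⟨S, hS, n, hn, hlt⟩ := hk₁
    exact ⟨k, hk₃, S, hS, n, hn, hlt, hk₂ S hS n hn⟩
  choose k hk S hS n hn hlt hle using key
  -- along the violating cutoffs the physical separation is large: `2 j / ε < a_k n`
  have hfar : ∀ j : ℕ, (j : ℝ) < ε / 2 * (reg.a (k j) * n j) := by
    intro j
    have hx : 0 ≤ reg.a (k j) * n j := mul_nonneg (reg.a_pos _).le (Nat.cast_nonneg _)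
    have h1 : C₁ * Real.exp j * Real.exp (-(ε / 2 * (reg.a (k j) * n j))) <
        C₁ * Real.exp (-(Δ * (reg.a (k j) * n j))) :=
      (hlt j).trans_le ((hle j).trans (mul_le_mul_of_nonneg_right hC₀1 (Real.exp_pos _).le))
    have h2 : Real.exp j * Real.exp (-(ε / 2 * (reg.a (k j) * n j))) <
        Real.exp (-(Δ * (reg.a (k j) * n j))) :=
      lt_of_mul_lt_mul_left (by simpa only [mul_assoc] using h1) (zero_le_one.trans hC₁1)
    rw [← Real.exp_add, Real.exp_lt_exp] at h2
    nlinarith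
  -- the selection `ψ 0 = k 0`, `ψ (i+1) = k (ψ i + 1)` through the levels `J 0 = 0`, `J (i+1) = ψ i + 1`
  obtain ⟨J, hJ0, hJs⟩ : ∃ J : ℕ → ℕ, J 0 = 0 ∧ ∀ i, J (i + 1) = k (J i) + 1 :=
    ⟨fun i => Nat.rec 0 (fun _ Ji => k Ji + 1) i, rfl, fun _ => rfl⟩
  have hJge : ∀ i, i ≤ J i := by
    intro i
    induction i with
    | zero => exact Nat.zero_le _
    | succ i ih => rw [hJs]; exact Nat.succ_le_succ (ih.trans (hk (J i)))
  set ψ : ℕ → ℕ := fun i => k (J i) with hψdef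
  have hψ : StrictMono ψ := by
    refine strictMono_nat_of_lt_succ fun i => ?_
    show k (J i) < k (J (i + 1))
    rw [hJs]
    exact Nat.lt_of_lt_of_le (Nat.lt_succ_self _) (hk _)
  refine ⟨ψ, hψ, m, hm, ε / 2, 1, half_lt_self hε, one_pos, R, R', A, B, fun i => S (J i), fun i => n (J i),
    fun i => hS (J i), fun i => hn (J i), ?_, Eventually.of_forall fun i => ?_⟩
  · -- `a_{ψ i} n_{J i} > 2 J i / ε ≥ 2 i / ε → ∞`
    have hlow : ∀ i, (2 / ε) * i ≤ (reg.restrict ψ hψ.tendsto_atTop).a i * n (J i) := by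
      intro i
      have h := hfar (J i)
      have hi : (i : ℝ) ≤ J i := by exact_mod_cast hJge i
      show (2 / ε) * i ≤ reg.a (k (J i)) * n (J i)
      rw [div_mul_eq_mul_div, div_le_iff₀ hε]
      nlinarith
    refine tendsto_atTop_mono hlow ?_
    exact Tendsto.const_mul_atTop (by positivity) tendsto_natCast_atTop_atTop
  · -- the lower bound `1 · e^{-(ε/2) a n} ≤ C₁ e^{J i} e^{-(ε/2) a n} < ‖corr‖`
    have h := hlt (J i)
    have hone : (1 : ℝ) * Real.exp (-(ε / 2 * (reg.a (k (J i)) * n (J i)))) ≤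
        C₁ * Real.exp (J i) * Real.exp (-(ε / 2 * (reg.a (k (J i)) * n (J i)))) := by
      refine mul_le_mul_of_nonneg_right ?_ (Real.exp_pos _).le
      exact one_le_mul_of_one_le_of_one_le hC₁1 (Real.one_le_exp (Nat.cast_nonneg _))
    exact (hone.trans h.le)

/-! ## §2 Transfer along eventual reindexings -/

/-- **The Goldstone bound at a rate passes along eventual reindexings.**  If `Θ₂ j = Θ₁ (θ j)` for all large `j` with
`θ → ∞`, a Goldstone bound at rate `ε` of `reg.restrict Θ₁` is one of `reg.restrict Θ₂`: same tuple, rate, constant and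
channel; tori `S ∘ θ` and separations `n ∘ θ` beyond the agreement index, and the scheme's own torus with separation `0`
before it (finitely many indices, invisible to `Tendsto`/`∀ᶠ`). -/
theorem hasGoldstoneBoundAt_restrict_of_eventuallyEq (reg : QCDRegularisation Nf) {Θ₁ Θ₂ θ : ℕ → ℕ}
    (hΘ₁ : Tendsto Θ₁ atTop atTop) (hΘ₂ : Tendsto Θ₂ atTop atTop) (hθ : Tendsto θ atTop atTop)
    (heq : ∀ᶠ j in atTop, Θ₂ j = Θ₁ (θ j)) {ε : ℝ} (h : (reg.restrict Θ₁ hΘ₁).HasGoldstoneBoundAt ε) :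
    (reg.restrict Θ₂ hΘ₂).HasGoldstoneBoundAt ε := by
  obtain ⟨m, hm, μ, c, hμ, hc, R, R', A, B, S, n, hLS, hnS, hdiv, hev⟩ := h
  obtain ⟨N, hN⟩ := eventually_atTop.1 heq
  classical
  refine ⟨m, hm, μ, c, hμ, hc, R, R', A, B, fun j => if N ≤ j then S (θ j) else reg.L (Θ₂ j),
    fun j => if N ≤ j then n (θ j) else 0, fun j => ?_, fun j => ?_, ?_, ?_⟩
  · by_cases hj : N ≤ j
    · simp only [if_pos hj]
      show reg.L (Θ₂ j) ≤ S (θ j)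
      rw [hN j hj]
      exact hLS (θ j)
    · simp only [if_neg hj]
      exact le_rfl
  · by_cases hj : N ≤ j
    · simp only [if_pos hj]
      exact hnS (θ j)
    · simp only [if_neg hj]
      exact Nat.zero_le _
  · have h1 : Tendsto (fun j => (reg.restrict Θ₁ hΘ₁).a (θ j) * n (θ j)) atTop atTop := hdiv.comp hθ
    refine h1.congr' ?_
    filter_upwards [eventually_ge_atTop N] with j hj
    simp only [if_pos hj]
    show reg.a (Θ₁ (θ j)) * n (θ j) = reg.a (Θ₂ j) * n (θ j)
    rw [hN j hj]
  · filter_upwards [hθ.eventually hev, eventually_ge_atTop N] with j hj hjN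
    simp only [if_pos hjN]
    have e := hN j hjN
    simp only [QCDRegularisation.scheme_mq, QCDRegularisation.restrict_a, QCDRegularisation.restrict_β,
      QCDRegularisation.restrict_mcrit, QCDRegularisation.restrict_Zm, Function.comp_apply] at hj ⊢
    rw [← e] at hj
    exact hj

/-! ## §3 The diagonal, and E from E* over C1 -/

/-- **The diagonal argument** (abstract form; adapted from `CertifiedSeaThresholdGraft.exists_diagonal`, which is
private to its file).  Properties `P i` of integer sequences that are (1) reachable from every strictly increasing
sequence by a further extraction and (2) stable under "is eventually a reindexing of" hold simultaneously along one
strictly increasing sequence. [folklore] -/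
theorem exists_diagonal {P : ℕ → (ℕ → ℕ) → Prop}
    (hstep : ∀ (i : ℕ) (ψ : ℕ → ℕ), StrictMono ψ → ∃ φ : ℕ → ℕ, StrictMono φ ∧ P i (ψ ∘ φ))
    (hher : ∀ (i : ℕ) (Θ₁ Θ₂ θ : ℕ → ℕ), StrictMono Θ₁ → StrictMono Θ₂ → Tendsto θ atTop atTop →
      (∀ᶠ j in atTop, Θ₂ j = Θ₁ (θ j)) → P i Θ₁ → P i Θ₂) :
    ∃ Φ : ℕ → ℕ, StrictMono Φ ∧ ∀ i, P i Φ := by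
  choose! nxt hmono hP using hstep
  -- the nested extractions `Ψ 0 = id`, `Ψ (i+1) = Ψ i ∘ φᵢ`
  obtain ⟨Ψ, hΨ0, hΨs⟩ : ∃ Ψ : ℕ → ℕ → ℕ, Ψ 0 = id ∧ ∀ i, Ψ (i + 1) = Ψ i ∘ nxt i (Ψ i) :=
    ⟨fun i => Nat.rec id (fun j Ψj => Ψj ∘ nxt j Ψj) i, rfl, fun _ => rfl⟩
  have hΨmono : ∀ i, StrictMono (Ψ i) := by
    intro i
    induction i with
    | zero => rw [hΨ0]; exact strictMono_id
    | succ i ih => rw [hΨs]; exact ih.comp (hmono i _ ih)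
  have hΨP : ∀ i, P i (Ψ (i + 1)) := fun i => by rw [hΨs]; exact hP i _ (hΨmono i)
  -- later extractions take values among earlier ones
  have hrange : ∀ i t n, ∃ n', Ψ (i + t) n = Ψ i n' := by
    intro i t
    induction t with
    | zero => exact fun n => ⟨n, rfl⟩
    | succ t ih =>
        intro n
        obtain ⟨n', hn'⟩ := ih (nxt (i + t) (Ψ (i + t)) n)
        exact ⟨n', by rw [← add_assoc, hΨs]; exact hn'⟩
  -- the diagonal sequence
  obtain ⟨Φ, hΦdef⟩ : ∃ Φ : ℕ → ℕ, ∀ j, Φ j = Ψ j j := ⟨fun j => Ψ j j, fun _ => rfl⟩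
  have hΦ : StrictMono Φ := by
    refine strictMono_nat_of_lt_succ fun j => ?_
    rw [hΦdef, hΦdef, hΨs]
    exact hΨmono j ((Nat.lt_add_one j).trans_le (hmono j _ (hΨmono j)).le_apply)
  refine ⟨Φ, hΦ, fun i => ?_⟩
  -- `Φ` is eventually a reindexing of `Ψ (i+1)`
  have hex : ∀ t, ∃ n', Ψ (i + 1) n' = Φ (i + 1 + t) := fun t => by
    obtain ⟨n', hn'⟩ := hrange (i + 1) t (i + 1 + t)
    exact ⟨n', by rw [hΦdef]; exact hn'.symm⟩
  choose ϑ hϑ using hex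
  have hϑmono : StrictMono ϑ := fun t t' htt' =>
    (hΨmono (i + 1)).lt_iff_lt.1 (by rw [hϑ, hϑ]; exact hΦ (by omega))
  refine hher i (Ψ (i + 1)) Φ (fun j => ϑ (j - (i + 1))) (hΨmono (i + 1)) hΦ
    (hϑmono.tendsto_atTop.comp (tendsto_sub_atTop_nat _)) ?_ (hΨP i)
  filter_upwards [eventually_ge_atTop (i + 1)] with j hj
  show Φ j = Ψ (i + 1) (ϑ (j - (i + 1)))
  rw [hϑ, Nat.add_sub_cancel' hj]

/-- **E from the hereditary pin over the lattice gap.**  If the pin `IsChiralAtZero` holds along EVERY subsequence of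
`reg` (E* with `φ = id`) and `reg` has a uniform lattice gap at every positive mass tuple (the conclusion of stub C1
for `reg`), then some subsequence of `reg` carries the eventual Goldstone bound at every rate: nested single-scale
selections at the rates `1/(i+1)` (each available because the current subsequence is still pinned, by heredity, and
still gapped, `hasLatticeMassGap_restrict`), then the diagonal, along which the bound at each rate survives
(`hasGoldstoneBoundAt_restrict_of_eventuallyEq`), and a null sequence of rates suffices (`hasGoldstoneBound_of_tendsto`). -/
theorem exists_restrict_hasGoldstoneBound (reg : QCDRegularisation Nf)
    (hher : ∀ (ψ : ℕ → ℕ) (hψ : StrictMono ψ), (reg.restrict ψ hψ.tendsto_atTop).IsChiralAtZero)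
    (hgap : ∀ m : Fin Nf → ℝ, (∀ f, 0 < m f) → ∃ Δ > 0, (reg.scheme m 0 0).HasLatticeMassGap Δ) :
    ∃ θ : ℕ → ℕ, ∃ hθ : StrictMono θ, (reg.restrict θ hθ.tendsto_atTop).HasGoldstoneBound := by
  obtain ⟨Φ, hΦ, hP⟩ := exists_diagonal
    (P := fun i Θ => ∀ hΘ : StrictMono Θ, (reg.restrict Θ hΘ.tendsto_atTop).HasGoldstoneBoundAt (1 / ((i : ℝ) + 1)))
    (fun i ψ hψ => by
      -- the current subsequence is pinned (heredity) and gapped (tail property): select at rate `1/(i+1)`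
      have hgapψ : ∀ m : Fin Nf → ℝ, (∀ f, 0 < m f) →
          ∃ Δ > 0, ((reg.restrict ψ hψ.tendsto_atTop).scheme m 0 0).HasLatticeMassGap Δ := fun m hm => by
        obtain ⟨Δ, hΔ, h⟩ := hgap m hm
        exact ⟨Δ, hΔ, hasLatticeMassGap_restrict reg ψ hψ m h⟩
      obtain ⟨σ, hσ, hGσ⟩ := exists_restrict_hasGoldstoneBoundAt (reg.restrict ψ hψ.tendsto_atTop) (hher ψ hψ)
        hgapψ (ε := 1 / ((i : ℝ) + 1)) Nat.one_div_pos_of_nat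
      exact ⟨σ, hσ, fun _ => hGσ⟩)
    (fun i Θ₁ Θ₂ θ hΘ₁ hΘ₂ hθ heq h1 hΘ₂' =>
      hasGoldstoneBoundAt_restrict_of_eventuallyEq reg hΘ₁.tendsto_atTop hΘ₂'.tendsto_atTop hθ heq (h1 hΘ₁))
  exact ⟨Φ, hΦ, QCDRegularisation.hasGoldstoneBound_of_tendsto tendsto_one_div_add_atTop_nhds_zero_nat
    fun i => hP i hΦ⟩

/-- The same with the hereditary pin along a first subsequence `reg.restrict φ` (the shape of the line's stub E*):
the Goldstone subsequence is `φ ∘ θ`. -/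
theorem exists_restrict_hasGoldstoneBound_of_hereditaryPin (reg : QCDRegularisation Nf) (φ : ℕ → ℕ)
    (hφ : StrictMono φ)
    (hher : ∀ (ψ : ℕ → ℕ) (hψ : StrictMono ψ),
      ((reg.restrict φ hφ.tendsto_atTop).restrict ψ hψ.tendsto_atTop).IsChiralAtZero)
    (hgap : ∀ m : Fin Nf → ℝ, (∀ f, 0 < m f) → ∃ Δ > 0, (reg.scheme m 0 0).HasLatticeMassGap Δ) :
    ∃ θ : ℕ → ℕ, ∃ hθ : StrictMono θ, (reg.restrict θ hθ.tendsto_atTop).HasGoldstoneBound := by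
  have hgapφ : ∀ m : Fin Nf → ℝ, (∀ f, 0 < m f) →
      ∃ Δ > 0, ((reg.restrict φ hφ.tendsto_atTop).scheme m 0 0).HasLatticeMassGap Δ := fun m hm => by
    obtain ⟨Δ, hΔ, h⟩ := hgap m hm
    exact ⟨Δ, hΔ, hasLatticeMassGap_restrict reg φ hφ m h⟩
  obtain ⟨θ, hθ, hG⟩ := exists_restrict_hasGoldstoneBound (reg.restrict φ hφ.tendsto_atTop) hher hgapφ
  exact ⟨φ ∘ θ, hφ.comp hθ, hG⟩

/-! ## §4 Calibration of E*: necessary for E, and free from an EVENTUAL pin -/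

/-- **E ⟹ E*.**  A subsequence with the Goldstone bound is hereditarily pinned (Literature
`HasGoldstoneBound.isChiralAtZero_restrict`): the weakened stub E* is implied by the form of E the composition consumes,
hence by the cycle-2 cores (`N_f = 2`: vanishing chiral rate along `φ`, via `stub_fmChiral_of_vanishingRate_two` →
`stub_secondMoment_of_fmChiral_two` → `stub_goldstone_of_secondMoment_two`; `N_f = 3`: the sign-input core). -/
theorem hereditaryPin_of_hasGoldstoneBound (reg : QCDRegularisation Nf) (φ : ℕ → ℕ) (hφ : StrictMono φ)
    (hG : (reg.restrict φ hφ.tendsto_atTop).HasGoldstoneBound) (ψ : ℕ → ℕ) (hψ : StrictMono ψ) :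
    ((reg.restrict φ hφ.tendsto_atTop).restrict ψ hψ.tendsto_atTop).IsChiralAtZero :=
  hG.isChiralAtZero_restrict ψ hψ.tendsto_atTop

/-- **An EVENTUAL pin is hereditary.**  If for every rate `ε > 0` some positive tuple and ONE channel violate the
`ε`-gap bound at every level `C` for ALL LARGE `k` (the `∀ᶠ`-upgrade of `IsChiralAtZero`, whose typed form only negates
an `∀ᶠ` clause and so asks the violations FREQUENTLY), then every subsequence of `reg` is chiral at zero — E* with
`φ = id`.  This is what an honestly constructed chiral regularisation delivers (the pion channel at small quark mass is
light at every fine enough cutoff), and it is the precise re-typing of the crux's hypothesis under which the E-stub of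
the line closes outright. -/
theorem hereditaryPin_of_eventual (reg : QCDRegularisation Nf)
    (h : ∀ ε > (0 : ℝ), ∃ m : Fin Nf → ℝ, (∀ f, 0 < m f) ∧
      ∃ (R R' : ℕ) (A : QCDLatticeObservable Nf R) (B : QCDLatticeObservable Nf R'), ∀ C : ℝ, ∀ᶠ k in atTop,
        ∃ S : ℕ, reg.L k ≤ S ∧ ∃ n : ℕ, n ≤ S ∧ C * Real.exp (-(ε * (reg.a k * n))) <
          ‖qcdLatticeConnectedCorr (reg.β k) (2 * S + 1) (fun fl => (reg.scheme m 0 0).mq fl k) A B n‖)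
    (ψ : ℕ → ℕ) (hψ : StrictMono ψ) : (reg.restrict ψ hψ.tendsto_atTop).IsChiralAtZero := by
  intro ε hε
  obtain ⟨m, hm, R, R', A, B, hAB⟩ := h ε hε
  refine ⟨m, hm, fun hgap => ?_⟩
  obtain ⟨C, hC⟩ := hgap R R' A B
  -- along `ψ`: the violation at level `C` (eventual in `k`, so eventual along `ψ`) meets the gap bound with constant `C`
  obtain ⟨j, hj₁, hj₂⟩ := ((hψ.tendsto_atTop.eventually (hAB C)).and hC).exists
  obtain ⟨S, hS, n, hn, hlt⟩ := hj₁
  exact absurd (hj₂ S hS n hn) (not_le.2 hlt)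

/-! ## §5 The reshaped composition of the line (rev 5): E* → C1 → C2 → crux -/

/-- **The composition of line `Sketch` over the WEAKENED chirality stub.**  A conditional theorem whose three hypotheses
are verbatim the registered stubs of skeleton rev 5: (E*) the hereditary pin along some subsequence, (C1) the signed
lattice gap at every positive tuple at the given critical line, (C2) the locally-`m`-uniform subsequential continuum half.
E is regained from E* and C1 (`exists_restrict_hasGoldstoneBound_of_hereditaryPin`) and fed to the landed composition
`chiralGluonicCompletion_of_stubs`. -/
theorem chiralGluonicCompletion_of_hereditaryPin : (∀ Nf : ℕ, Nf = 2 ∨ Nf = 3 → ∀ reg : QCDRegularisation Nf, Hyp Nf reg → ∃ φ : ℕ → ℕ, ∃ hφ : StrictMono φ, ∀ (ψ : ℕ → ℕ) (hψ : StrictMono ψ), ((reg.restrict φ hφ.tendsto_atTop).restrict ψ hψ.tendsto_atTop).IsChiralAtZero) → (∀ Nf : ℕ, Nf = 2 ∨ Nf = 3 → ∀ reg : QCDRegularisation Nf, Hyp Nf reg → ∀ m : Fin Nf → ℝ, (∀ f, 0 < m f) → ∃ Δ > 0, (reg.scheme m 0 0).HasLatticeMassGap Δ) → (∀ Nf : ℕ,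 Nf = 2 ∨ Nf = 3 → ∀ reg : QCDRegularisation Nf, Hyp Nf reg → ∀ m₀ : Fin Nf → ℝ, (∀ f, 0 < m₀ f) → ∃ ε : ℝ, 0 < ε ∧ ∀ (ψ : ℕ → ℕ) (hψ : StrictMono ψ), ∃ (φ : ℕ → ℕ) (hφ : StrictMono φ), ∀ m : Fin Nf → ℝ, (∀ f, 0 < m f) → (∀ f, |m f - m₀ f| < ε) → ContinuumBody Nf (reg.restrict (ψ ∘ φ) (hψ.comp hφ).tendsto_atTop) m) → Summit.QuantumFields.QCD.Theses.PauliWegnerSea.ChiralGluonicCompletion :=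
  fun hE hC1 hC2 => chiralGluonicCompletion_of_stubs (fun Nf hNf reg hH => by
    obtain ⟨φ, hφ, hher⟩ := hE Nf hNf reg hH
    exact exists_restrict_hasGoldstoneBound_of_hereditaryPin reg φ hφ hher (hC1 Nf hNf reg hH)) hC1 hC2

end Summit.QuantumFields.QCD.Theorems.StronglyChiralSubsequence

end
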